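import Summits.AtomisticToContinuum.Crystallization.Theorems.GappedShellCensusCleanLimitsHaveWindowsVerticalPinning5
import Summits.AtomisticToContinuum.Crystallization.Theorems.GappedShellCensusCleanLimitsHaveWindowsVerticalPinning1

/-!
# Vertical pinning, part 6: many shifted gaps and the density closing

Helper for the registered stub `stub_verticalPinning` (T4b-iv) of line `Sketch` of the crux
`GappedShellCensus.CleanLimitsHaveWindows` (stmt-AtomisticToContinuum-15932).

* `vp_many_gaps` — shifting a finite set `T` of bad gaps one after the other (`vpShiftSet`: the layers
  above each gap of `T` moved by `θ`) keeps the increments admissible and, by the single-gap bookkeeping of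
  part 5, lowers the window sum of the registry energies by at least `#T · κ`, `κ = 2 Σ k λ_k − 2 μ Z`.
* `vp_closing` — the density closing in the pattern of `LayeredHull.clo_partA/B`: if a bad increment recurs
  with bounded gaps `G`, every window of `n''(G+1)` gaps contains `n''` bad ones (`LayeredHull.clo_count`);
  the hull upper bound (U) on the prism of the layered set against the free lower bound (L) on the prism of
  the competitor with the shifted heights (`LayeredHull.stub_windowBounds`, the layer cake on the clean band
  as a hypothesis), at EQUAL cardinality `nK²`, bounds the same window sum by a constant
  (`bp_meanStress_le`) — absurd for `n''` large when `κ > 0`;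
* `vp_pair_height` — the height of a pair of layers straddling a gap, from the increment bounds
  (`LayeredHull.ext_growth`). [folklore]
-/

noncomputable section

namespace Summit.AtomisticToContinuum.Crystallization.Theorems.CleanHull

open scoped BigOperators
open Finset Filter Literature.MathematicalPhysics.StatisticalMechanics

/-! ## Shifting a finite set of gaps -/

/-- The heights with the layers above every gap of `T` moved by `θ` (a layer above `k` gaps of `T` moves by
`k θ`). [folklore] -/
def vpShiftSet (ζ : ℤ → ℝ) (T : Finset ℤ) (θ : ℝ) (m : ℤ) : ℝ := ζ m + θ * ((T.filter (· < m)).card : ℝ)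

/-- No gap shifted. [folklore] -/
theorem vpShiftSet_empty (ζ : ℤ → ℝ) (θ : ℝ) : vpShiftSet ζ ∅ θ = ζ := by
  funext m; simp [vpShiftSet]

/-- One more gap shifted. [folklore] -/
theorem vpShiftSet_insert (ζ : ℤ → ℝ) {T : Finset ℤ} {g : ℤ} (hg : g ∉ T) (θ : ℝ) :
    vpShiftSet ζ (insert g T) θ = vpShift (vpShiftSet ζ T θ) g θ := by
  funext m
  simp only [vpShiftSet, vpShift, Finset.filter_insert]
  split_ifs with h
  · rw [Finset.card_insert_of_notMem (fun h' => hg (Finset.mem_filter.1 h').1)]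
    push_cast; ring
  · ring

/-- The increments of the shifted heights: `Δ'_l = Δ_l + θ·1[l ∈ T]`. [folklore] -/
theorem vpShiftSet_incr (ζ : ℤ → ℝ) (T : Finset ℤ) (θ : ℝ) (l : ℤ) :
    vpShiftSet ζ T θ (l + 1) - vpShiftSet ζ T θ l = ζ (l + 1) - ζ l + if l ∈ T then θ else 0 := by
  classical
  simp only [vpShiftSet]
  have hsplit : T.filter (· < l + 1) = T.filter (· < l) ∪ T.filter (fun a => a = l) := by
    ext a
    simp only [Finset.mem_filter, Finset.mem_union]
    constructor
    · rintro ⟨ha, h⟩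
      rcases lt_or_eq_of_le (Int.lt_add_one_iff.1 h) with h' | h'
      · exact Or.inl ⟨ha, h'⟩
      · exact Or.inr ⟨ha, h'⟩
    · rintro (⟨ha, h⟩ | ⟨ha, h⟩)
      · exact ⟨ha, by omega⟩
      · exact ⟨ha, by omega⟩
  have hdisj : Disjoint (T.filter (· < l)) (T.filter (fun a => a = l)) :=
    Finset.disjoint_filter.2 fun a _ h h' => by omega
  rw [hsplit, Finset.card_union_of_disjoint hdisj, Finset.filter_eq']
  split_ifs with h
  · simp; ring
  · simp

/-- **Many shifted gaps.** For admissible heights (`Δ_l ∈ [pb, qb]`), a shift `θ` keeping bad increments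
admissible, summable layer families for admissible heights, and the pair bounds of part 5 for admissible
heights at a bad gap: shifting any finite set `T` of bad gaps inside `[m₁ + 4, m₁ + n − 6]` keeps the heights
admissible and lowers the window sum by at least `#T · (2 Σ k λ_k − 2 μ Z)`. [folklore] -/
theorem vp_many_gaps (b : ℝ) (s : ℤ → ℤ) (z : ℤ → ℝ) (p q θ : ℝ) (Bad : ℝ → Prop) (lam : ℕ → ℝ)
    (μ : ℝ) (hμ : 0 ≤ μ)
    (hz : ∀ l : ℤ, p * b ≤ z (l + 1) - z l ∧ z (l + 1) - z l ≤ q * b)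
    (hAdmBad : ∀ Δ : ℝ, p * b ≤ Δ → Δ ≤ q * b → Bad Δ → p * b ≤ Δ + θ ∧ Δ + θ ≤ q * b)
    (hsum : ∀ ζ : ℤ → ℝ, (∀ l : ℤ, p * b ≤ ζ (l + 1) - ζ l ∧ ζ (l + 1) - ζ l ≤ q * b) →
      ∀ m : ℤ, Summable fun m' : ℤ => if m' = m then (0 : ℝ) else
        layerInteraction lennardJones b (ζ m' - ζ m) (haggLabel s m' - haggLabel s m) 1)
    (hpair : ∀ ζ : ℤ → ℝ, (∀ l : ℤ, p * b ≤ ζ (l + 1) - ζ l ∧ ζ (l + 1) - ζ l ≤ q * b) →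
      ∀ g : ℤ, Bad (ζ (g + 1) - ζ g) → ∀ m m' : ℤ, m ≤ g → g < m' → vpW lam μ (m' - m).toNat ≤
        layerInteraction lennardJones b (ζ m' - ζ m) (haggLabel s m' - haggLabel s m) 1 -
          layerInteraction lennardJones b (ζ m' - ζ m + θ) (haggLabel s m' - haggLabel s m) 1)
    (m₁ : ℤ) (n : ℕ) (T : Finset ℤ)
    (hT : ∀ g ∈ T, Bad (z (g + 1) - z g) ∧ m₁ + 4 ≤ g ∧ g + 6 ≤ m₁ + n) :
    (∀ l : ℤ, p * b ≤ vpShiftSet z T θ (l + 1) - vpShiftSet z T θ l ∧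
        vpShiftSet z T θ (l + 1) - vpShiftSet z T θ l ≤ q * b) ∧
      (T.card : ℝ) * (2 * (∑ k ∈ Finset.range 6, (k : ℝ) * lam k) - 2 * (μ * (1 / 4 * (6 / 625 + 1 / 375)))) ≤
        ∑ m ∈ Finset.Ico m₁ (m₁ + n), (vpT b s z m - vpT b s (vpShiftSet z T θ) m) := by
  classical
  induction T using Finset.induction_on with
  | empty =>
    refine ⟨fun l => ?_, ?_⟩
    · rw [vpShiftSet_empty]; exact hz l
    · simp [vpShiftSet_empty]
  | insert g T hgT ih =>
    obtain ⟨hAdmT, hineqT⟩ := ih fun g' hg' => hT g' (Finset.mem_insert_of_mem hg')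
    obtain ⟨hBad, hg1, hg2⟩ := hT g (Finset.mem_insert_self g T)
    -- the new gap is still bad in the partially shifted profile
    have hBadT : Bad (vpShiftSet z T θ (g + 1) - vpShiftSet z T θ g) := by
      rw [vpShiftSet_incr, if_neg hgT, add_zero]; exact hBad
    -- admissibility of the new profile
    have hAdmNew : ∀ l : ℤ, p * b ≤ vpShiftSet z (insert g T) θ (l + 1) - vpShiftSet z (insert g T) θ l ∧
        vpShiftSet z (insert g T) θ (l + 1) - vpShiftSet z (insert g T) θ l ≤ q * b := by
      intro l
      rw [vpShiftSet_incr]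
      by_cases hl : l = g
      · subst hl
        rw [if_pos (Finset.mem_insert_self l T)]
        exact hAdmBad _ (hz l).1 (hz l).2 hBad
      · have e : (if l ∈ insert g T then θ else (0 : ℝ)) = if l ∈ T then θ else 0 := by
          simp [Finset.mem_insert, hl]
        rw [e]
        have := hAdmT l
        rwa [vpShiftSet_incr] at this
    refine ⟨hAdmNew, ?_⟩
    -- the single-gap bookkeeping for the partially shifted profile
    have hsum' : ∀ m : ℤ, Summable fun m' : ℤ => if m' = m then (0 : ℝ) else
        layerInteraction lennardJones b (vpShift (vpShiftSet z T θ) g θ m' - vpShift (vpShiftSet z T θ) g θ m)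
          (haggLabel s m' - haggLabel s m) 1 := by
      rw [← vpShiftSet_insert z hgT θ]; exact hsum _ hAdmNew
    have hone := vp_single_gap b s (vpShiftSet z T θ) g θ lam μ hμ (hsum _ hAdmT) hsum'
      (hpair _ hAdmT g hBadT) m₁ n hg1 hg2
    rw [← vpShiftSet_insert z hgT θ] at hone
    rw [Finset.card_insert_of_notMem hgT]
    have hsplit : ∑ m ∈ Finset.Ico m₁ (m₁ + n), (vpT b s z m - vpT b s (vpShiftSet z (insert g T) θ) m) =
        ∑ m ∈ Finset.Ico m₁ (m₁ + n), (vpT b s z m - vpT b s (vpShiftSet z T θ) m) +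
        ∑ m ∈ Finset.Ico m₁ (m₁ + n), (vpT b s (vpShiftSet z T θ) m - vpT b s (vpShiftSet z (insert g T) θ) m) := by
      rw [← Finset.sum_add_distrib]
      exact Finset.sum_congr rfl fun m _ => by ring
    rw [hsplit]
    push_cast
    linarith

/-! ## The density closing -/

/-- **The density closing for a recurrent bad increment.** Let `S = A(S(b, s, z))` (`b ∈ [9/10, 11/10]`,
increments in `[pb, qb]`, `p ≥ 7/10`) lie in the hull of a sequence of Lennard-Jones ground states, and let a
property `Bad` of increments recur with bounded gaps. Suppose a shift `θ` keeps bad increments admissible and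
the pair bounds of part 5 hold for all admissible heights at a bad gap, with `κ = 2 Σ k λ_k − 2 μ Z > 0`.
Then, given the layer cake on the clean band, contradiction: on the prism `W(0, n, K)` the hull upper bound
(U) for `S` against the free lower bound (L) for the competitor with all bad gaps of the window shifted —
same word, same cardinality `nK²` — gives `K²·(#bad gaps)·κ ≤ C(nK + K²)`, while the bad gaps have positive
density. [folklore] -/
theorem vp_closing (x : (N : ℕ) → (Fin N → EuclideanSpace ℝ (Fin 3)))
    (hx : ∀ N, IsGroundState lennardJones (x N)) (b : ℝ) (hb9 : 9 / 10 ≤ b) (hb11 : b ≤ 11 / 10)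
    (A : EuclideanSpace ℝ (Fin 3) →ₗᵢ[ℝ] EuclideanSpace ℝ (Fin 3)) (s : ℤ → ℤ) (z : ℤ → ℝ)
    (p q : ℝ) (hp7 : 7 / 10 ≤ p) (hz : ∀ l : ℤ, p * b ≤ z (l + 1) - z l ∧ z (l + 1) - z l ≤ q * b)
    (hH : ∀ R ε : ℝ, 0 < ε → ∃ᶠ N in atTop, ∃ t : EuclideanSpace ℝ (Fin 3),
      (∀ p ∈ {p : EuclideanSpace ℝ (Fin 3) | ∃ m i j : ℤ, p = A (((i : ℝ) • triangularVec₁ b) +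
          ((j : ℝ) • triangularVec₂ b) + ((haggLabel s m : ℝ) • barlowOffset b) + (z m • layerNormal 1))},
        ‖p‖ ≤ R → ∃ i : Fin N, dist (x N i + t) p ≤ ε) ∧
      (∀ i : Fin N, ‖x N i + t‖ ≤ R → ∃ p ∈ {p : EuclideanSpace ℝ (Fin 3) | ∃ m i j : ℤ,
          p = A (((i : ℝ) • triangularVec₁ b) + ((j : ℝ) • triangularVec₂ b) +
            ((haggLabel s m : ℝ) • barlowOffset b) + (z m • layerNormal 1))}, dist (x N i + t) p ≤ ε))
    (θ : ℝ) (Bad : ℝ → Prop) (lam : ℕ → ℝ) (μ : ℝ) (hμ : 0 ≤ μ)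
    (hκ : 0 < 2 * (∑ k ∈ Finset.range 6, (k : ℝ) * lam k) - 2 * (μ * (1 / 4 * (6 / 625 + 1 / 375))))
    (hAdmBad : ∀ Δ : ℝ, p * b ≤ Δ → Δ ≤ q * b → Bad Δ → p * b ≤ Δ + θ ∧ Δ + θ ≤ q * b)
    (hpair : ∀ ζ : ℤ → ℝ, (∀ l : ℤ, p * b ≤ ζ (l + 1) - ζ l ∧ ζ (l + 1) - ζ l ≤ q * b) →
      ∀ g : ℤ, Bad (ζ (g + 1) - ζ g) → ∀ m m' : ℤ, m ≤ g → g < m' → vpW lam μ (m' - m).toNat ≤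
        layerInteraction lennardJones b (ζ m' - ζ m) (haggLabel s m' - haggLabel s m) 1 -
          layerInteraction lennardJones b (ζ m' - ζ m + θ) (haggLabel s m' - haggLabel s m) 1)
    (hevent : ∃ G : ℕ, ∀ m : ℤ, ∃ g : ℤ, 0 ≤ g ∧ g ≤ G ∧ Bad (z (m + g + 1) - z (m + g)))
    (hcake : ∃ C : ℝ, ∀ a : ℝ, 9 / 10 ≤ a → a ≤ 11 / 10 →
      (∀ (H : ℝ) (δ : ℤ), 7 / 10 ≤ |H| → |layerInteraction lennardJones a H δ 1| ≤ C / H ^ 4) ∧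
      ∀ (A : (EuclideanSpace ℝ (Fin 3)) →ₗᵢ[ℝ] (EuclideanSpace ℝ (Fin 3))) (s : ℤ → ℤ) (z : ℤ → ℝ),
        (∀ m : ℤ, 7 / 10 * a ≤ z (m + 1) - z m) →
        let S : Set (EuclideanSpace ℝ (Fin 3)) := {p | ∃ m i j : ℤ, p = A (((i : ℝ) • triangularVec₁ a) +
          ((j : ℝ) • triangularVec₂ a) + ((haggLabel s m : ℝ) • barlowOffset a) + (z m • layerNormal 1))};
        (∀ p ∈ S, ∀ q ∈ S, p ≠ q → 1 / 2 ≤ dist p q) ∧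
        (∀ m : ℤ, Summable fun m' : ℤ => if m' = m then (0 : ℝ) else
          layerInteraction lennardJones a (z m' - z m) (haggLabel s m' - haggLabel s m) 1) ∧
        (∀ m i j : ℤ,
          (∑' q : {q : (EuclideanSpace ℝ (Fin 3)) // q ∈ S ∧ q ≠ A (((i : ℝ) • triangularVec₁ a) + ((j : ℝ) • triangularVec₂ a) +
              ((haggLabel s m : ℝ) • barlowOffset a) + (z m • layerNormal 1))},
            lennardJones (dist (A (((i : ℝ) • triangularVec₁ a) + ((j : ℝ) • triangularVec₂ a) +
              ((haggLabel s m : ℝ) • barlowOffset a) + (z m • layerNormal 1))) (q : (EuclideanSpace ℝ (Fin 3))))) =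
          inLayerInteraction lennardJones a + ∑' m' : ℤ, if m' = m then (0 : ℝ) else
            layerInteraction lennardJones a (z m' - z m) (haggLabel s m' - haggLabel s m) 1) ∧
        (∀ (m₁ : ℤ) (n K : ℕ),
          let W : Finset (EuclideanSpace ℝ (Fin 3)) := ((Finset.Ico m₁ (m₁ + n)) ×ˢ ((Finset.range K) ×ˢ (Finset.range K))).image
            fun t : ℤ × (ℕ × ℕ) => A (((((t.2.1 : ℤ) - haggLabel s t.1 / 3 : ℤ) : ℝ) • triangularVec₁ a) +
              ((((t.2.2 : ℤ) - haggLabel s t.1 / 3 : ℤ) : ℝ) • triangularVec₂ a) +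
              ((haggLabel s t.1 : ℝ) • barlowOffset a) + (z t.1 • layerNormal 1));
          (↑W : Set (EuclideanSpace ℝ (Fin 3))) ⊆ S ∧ W.card = n * K ^ 2 ∧
          (∑ p ∈ W, (∑' q : {q : (EuclideanSpace ℝ (Fin 3)) // q ∈ S ∧ q ≠ p}, lennardJones (dist p (q : (EuclideanSpace ℝ (Fin 3)))))) =
            (K : ℝ) ^ 2 * ∑ m ∈ Finset.Ico m₁ (m₁ + n), (inLayerInteraction lennardJones a +
              ∑' m' : ℤ, if m' = m then (0 : ℝ) else
                layerInteraction lennardJones a (z m' - z m) (haggLabel s m' - haggLabel s m) 1) ∧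
          (∑ p ∈ W, (1 + Metric.infDist p (S \ (↑W : Set (EuclideanSpace ℝ (Fin 3)))))⁻¹ ^ 3) ≤ C * (n * K + K ^ 2))) :
    False := by
  classical
  have hb0 : 0 < b := by linarith
  -- constants
  obtain ⟨CU, hU⟩ := LayeredHull.stub_windowBounds.1
  obtain ⟨CL, hL⟩ := LayeredHull.stub_windowBounds.2 (1 / 2) (by norm_num)
  obtain ⟨Cc, hcake'⟩ := hcake
  obtain ⟨-, hcakeB⟩ := hcake' b hb9 hb11
  set κ : ℝ := 2 * (∑ k ∈ Finset.range 6, (k : ℝ) * lam k) - 2 * (μ * (1 / 4 * (6 / 625 + 1 / 375))) with hκ_def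
  -- admissible heights have increments `≥ 7b/10`, hence the layer cake applies
  have hadm7 : ∀ ζ : ℤ → ℝ, (∀ l : ℤ, p * b ≤ ζ (l + 1) - ζ l ∧ ζ (l + 1) - ζ l ≤ q * b) →
      ∀ m : ℤ, 7 / 10 * b ≤ ζ (m + 1) - ζ m := fun ζ hζ m => by
    have := (hζ m).1; nlinarith
  have hsum : ∀ ζ : ℤ → ℝ, (∀ l : ℤ, p * b ≤ ζ (l + 1) - ζ l ∧ ζ (l + 1) - ζ l ≤ q * b) →
      ∀ m : ℤ, Summable fun m' : ℤ => if m' = m then (0 : ℝ) else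
        layerInteraction lennardJones b (ζ m' - ζ m) (haggLabel s m' - haggLabel s m) 1 := fun ζ hζ =>
    (hcakeB A s ζ (hadm7 ζ hζ)).2.1
  -- the recurrence gap and the number of blocks
  obtain ⟨G, hG⟩ := hevent
  obtain ⟨n'', hn''⟩ := exists_nat_gt ((|CU| + |CL|) * Cc / κ)
  set n : ℕ := n'' * (G + 1) + 10 with hn
  -- the bad gaps of the window `[0, n)` away from its ends
  set T : Finset ℤ := (Finset.Ico (4 : ℤ) (4 + ((n'' * (G + 1) : ℕ) : ℤ))).filter
    fun g => Bad (z (g + 1) - z g) with hT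
  have hTprop : ∀ g ∈ T, Bad (z (g + 1) - z g) ∧ (0 : ℤ) + 4 ≤ g ∧ g + 6 ≤ 0 + n := by
    intro g hg
    rw [hT, Finset.mem_filter, Finset.mem_Ico] at hg
    refine ⟨hg.2, by omega, ?_⟩
    have h2 := hg.1.2
    rw [hn]; push_cast at h2 ⊢; linarith
  have hTcard : (n'' : ℝ) ≤ T.card := by
    have hc := LayeredHull.clo_count (fun g => Bad (z (g + 1) - z g)) G 4 (fun m => by
      obtain ⟨g, hg0, hgG, hB⟩ := hG m
      exact ⟨g, hg0, hgG, hB⟩) n''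
    rw [Finset.sum_boole] at hc
    rw [hT]
    exact_mod_cast hc
  -- the competitor and the window inequality
  obtain ⟨hAdmT, hwin⟩ := vp_many_gaps b s z p q θ Bad lam μ hμ hz hAdmBad hsum hpair 0 n T hTprop
  -- the mean-stress bound `Σ_window (T z − T z_T) ≤ (|CU| + |CL|) Cc`
  obtain ⟨-, -, -, hprism⟩ := hcakeB A s z (hadm7 z hz)
  obtain ⟨hsep', -, -, hprism'⟩ := hcakeB A s (vpShiftSet z T θ) (hadm7 _ hAdmT)
  have hmean : ∑ m ∈ Finset.Ico (0 : ℤ) (0 + n), (vpT b s z m - vpT b s (vpShiftSet z T θ) m) ≤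
      (|CU| + |CL|) * Cc := by
    have key : ∑ m ∈ Finset.Ico (0 : ℤ) (0 + n),
        ((inLayerInteraction lennardJones b + vpT b s z m) -
          (inLayerInteraction lennardJones b + vpT b s (vpShiftSet z T θ) m)) ≤ (|CU| + |CL|) * Cc := by
      refine bp_meanStress_le (ε := fun m => inLayerInteraction lennardJones b + vpT b s z m)
        (ε' := fun m => inLayerInteraction lennardJones b + vpT b s (vpShiftSet z T θ) m) 0 n fun K _ => ?_
      obtain ⟨hWsub, hWcard, hWsum, hWbd⟩ := hprism 0 n K
      obtain ⟨hW'sub, hW'card, hW'sum, hW'bd⟩ := hprism' 0 n K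
      have hUw := hU x hx _ hH _ hWsub
      have hLw := hL _ hsep' _ hW'sub
      rw [hWcard, hWsum] at hUw
      rw [hW'card, hW'sum] at hLw
      have hUw' := LayeredHull.clo_absorb_upper hUw hWbd (Finset.sum_nonneg fun p _ =>
        pow_nonneg (inv_nonneg.2 (add_nonneg zero_le_one Metric.infDist_nonneg)) 3)
      have hLw' := LayeredHull.clo_absorb_lower hLw hW'bd (Finset.sum_nonneg fun p _ =>
        pow_nonneg (inv_nonneg.2 (add_nonneg zero_le_one Metric.infDist_nonneg)) 3)
      unfold vpT
      rw [Finset.sum_sub_distrib, mul_sub]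
      linarith
    refine le_trans (le_of_eq (Finset.sum_congr rfl fun m _ => by ring)) key
  -- contradiction
  have h1 : (n'' : ℝ) * κ ≤ (T.card : ℝ) * κ := mul_le_mul_of_nonneg_right hTcard hκ.le
  have h2 : (T.card : ℝ) * κ ≤ (|CU| + |CL|) * Cc := hwin.trans hmean
  have h3 : (n'' : ℝ) ≤ (|CU| + |CL|) * Cc / κ := by rw [le_div_iff₀ hκ]; linarith
  linarith

/-! ## Heights of straddling pairs -/

/-- The height of a pair of layers `m ≤ g < m'` at distance `k`: between `P_g + P(k−1)` and `Q_g + Q(k−1)`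
if the increments lie in `[P, Q]` and the increment at `g` in `[P_g, Q_g]`. [folklore] -/
theorem vp_pair_height {ζ : ℤ → ℝ} {P Q Pg Qg : ℝ} {g : ℤ}
    (h : ∀ l : ℤ, P ≤ ζ (l + 1) - ζ l ∧ ζ (l + 1) - ζ l ≤ Q) (hg1 : Pg ≤ ζ (g + 1) - ζ g)
    (hg2 : ζ (g + 1) - ζ g ≤ Qg) {m m' : ℤ} (hm : m ≤ g) (hm' : g < m') :
    Pg + P * ((((m' - m).toNat : ℕ) : ℝ) - 1) ≤ ζ m' - ζ m ∧
      ζ m' - ζ m ≤ Qg + Q * ((((m' - m).toNat : ℕ) : ℝ) - 1) := by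
  obtain ⟨i, hi⟩ : ∃ i : ℕ, m = g - i := ⟨(g - m).toNat, by omega⟩
  obtain ⟨j, hj⟩ : ∃ j : ℕ, m' = g + 1 + j := ⟨(m' - g - 1).toNat, by omega⟩
  have hk : ((((m' - m).toNat : ℕ) : ℝ)) - 1 = i + j := by
    rw [show (m' - m).toNat = i + j + 1 by omega]; push_cast; ring
  have h1 := LayeredHull.ext_growth h (g + 1) j
  have h2 := LayeredHull.ext_growth h (g - i) i
  rw [show g - (i : ℤ) + i = g by ring] at h2
  rw [hk, hj, hi]
  constructor <;> nlinarith [h1.1, h1.2, h2.1, h2.2]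

end Summit.AtomisticToContinuum.Crystallization.Theorems.CleanHull

end
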